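import Summits.QuantumAdvantage.QuantumAdvantage.Theorems.SosSandwichPseudoBoundedClosureA

/-! # SosSandwichPseudoBoundedClosure — part 2/2 (mechanical split for landing of `SosSandwichPseudoBoundedClosure`; content verbatim; scopes re-opened with their variables) -/

set_option linter.dupNamespace false
set_option linter.unusedVariables false
noncomputable section

namespace Summit.QuantumAdvantage.QuantumAdvantage.Theorems.SosSandwich
open MvPolynomial Finset
open Literature.Computability.QuantumComplexity
variable {N : ℕ}

namespace PseudoBounded
variable {T T' : ℕ} {p p' : MvPolynomial (Fin N) ℝ}

/-- `K` is closed under finite products, orders adding (AND of independent or dependent runs).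
[folklore] -/
theorem prod {ι : Type*} (s : Finset ι) (P : ι → MvPolynomial (Fin N) ℝ) (d : ι → ℕ)
    (h : ∀ i ∈ s, PseudoBounded (d i) (P i)) : PseudoBounded (∑ i ∈ s, d i) (∏ i ∈ s, P i) := by
  classical
  induction s using Finset.induction_on with
  | empty =>
    simpa using (pseudoBounded_C (N := N) zero_le_one le_rfl 0)
  | insert a s ha ih =>
    rw [Finset.prod_insert ha, Finset.sum_insert ha]
    exact PseudoBounded.mul (h a (Finset.mem_insert_self a s))
      (ih fun i hi => h i (Finset.mem_insert_of_mem hi))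

/-- **OR of a family stays in `K`**: `1 - ∏ᵢ (1 - Pᵢ) ∈ K_{Σ dᵢ}` (complement, product, complement).
This is the outer layer of the saturation amplifier (OR over fresh copies of a detector).
[folklore] -/
theorem orFamily {ι : Type*} (s : Finset ι) (P : ι → MvPolynomial (Fin N) ℝ) (d : ι → ℕ)
    (h : ∀ i ∈ s, PseudoBounded (d i) (P i)) :
    PseudoBounded (∑ i ∈ s, d i) (1 - ∏ i ∈ s, (1 - P i)) :=
  (prod s (fun i => 1 - P i) d fun i hi => (h i hi).one_sub).one_sub

/-- `K_T` is convex, and mixing with constants stays inside: `λ p + (1-λ) p' ∈ K_T` for `λ ∈ [0,1]`.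
[folklore] -/
theorem convexComb (h : PseudoBounded T p) (h' : PseudoBounded T p') {l : ℝ} (h0 : 0 ≤ l)
    (h1 : l ≤ 1) : PseudoBounded T (C l * p + C (1 - l) * p') := by
  rw [pseudoBounded_iff_cubeSOS] at h h' ⊢
  obtain ⟨hq, hr⟩ := h
  obtain ⟨hq', hr'⟩ := h'
  refine ⟨((hq.smul h0).add (hq'.smul (sub_nonneg.mpr h1))).congr fun x => ?_,
    ((hr.smul h0).add (hr'.smul (sub_nonneg.mpr h1))).congr fun x => ?_⟩
  · unfold evalBool; simp only [map_add, map_mul, eval_C]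
  · unfold evalBool; simp only [map_add, map_mul, eval_C]; ring

/-- `K_T` is closed under renaming of variables (identifications and embeddings into fresh copies):
`(rename φ p)(y) = p(y ∘ φ)`. [folklore] -/
theorem rename {N' : ℕ} (φ : Fin N → Fin N') (h : PseudoBounded T p) :
    PseudoBounded T (MvPolynomial.rename φ p) := by
  rw [pseudoBounded_iff_cubeSOS] at h ⊢
  obtain ⟨hq, hr⟩ := h
  have key : ∀ y : Fin N' → Bool, evalBool (MvPolynomial.rename φ p) y = evalBool p (y ∘ φ) := by
    intro y; unfold evalBool; rw [eval_rename]; rfl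
  exact ⟨(hq.rename φ).congr fun y => key y, (hr.rename φ).congr fun y => by rw [key]⟩

/-- **Bernstein-positive post-processing stays in `K`**: for `p ∈ K_T` and coefficients
`b₀,…,b_D ∈ [0,1]`, the polynomial `Σ_k b_k (D choose k) p^k (1-p)^{D-k}` lies in `K_{D·T}` — its
complement is the same expression with `1 - b_k` (binomial theorem). (Classical reading: run the
algorithm `D` times and accept with probability `b_k` on `k` successes; `Maj₃` is `D = 3`,
`b = (0,0,1,1)`.) [folklore] -/
theorem bernstein (h : PseudoBounded T p) (D : ℕ) (b : ℕ → ℝ) (hb0 : ∀ k, 0 ≤ b k)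
    (hb1 : ∀ k, b k ≤ 1) :
    PseudoBounded (D * T)
      (∑ k ∈ Finset.range (D + 1), C (b k * (D.choose k : ℝ)) * p ^ k * (1 - p) ^ (D - k)) := by
  have hP := h
  rw [pseudoBounded_iff_cubeSOS] at h ⊢
  obtain ⟨hq, hr⟩ := h
  -- each Bernstein basis element `p^k (1-p)^(D-k)`, `k ≤ D`, is cube-SOS of degree `D T`
  have basis : ∀ k ∈ Finset.range (D + 1),
      CubeSOS (D * T) (fun x => evalBool p x ^ k * (1 - evalBool p x) ^ (D - k)) := by
    intro k hk
    have hkD : k ≤ D := Nat.lt_succ_iff.mp (Finset.mem_range.mp hk)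
    have h1 : CubeSOS (∑ _i ∈ Finset.range k, T) (fun x => ∏ _i ∈ Finset.range k, evalBool p x) :=
      CubeSOS.prod (Finset.range k) (fun _ => evalBool p) (fun _ => T) fun _ _ => hq
    have h2 : CubeSOS (∑ _i ∈ Finset.range (D - k), T)
        (fun x => ∏ _i ∈ Finset.range (D - k), (1 - evalBool p x)) :=
      CubeSOS.prod (Finset.range (D - k)) (fun _ x => 1 - evalBool p x) (fun _ => T) fun _ _ => hr
    have h12 := h1.mul h2
    refine (h12.congr fun x => by simp [Finset.prod_const, Finset.card_range]).mono ?_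
    simp only [Finset.sum_const, Finset.card_range, smul_eq_mul]
    have : k * T + (D - k) * T = D * T := by
      rw [← Nat.add_mul, Nat.add_sub_cancel' hkD]
    exact this.le
  have evB : ∀ (c : ℕ → ℝ) (x : Fin N → Bool),
      evalBool (∑ k ∈ Finset.range (D + 1), C (c k * (D.choose k : ℝ)) * p ^ k * (1 - p) ^ (D - k)) x =
        ∑ k ∈ Finset.range (D + 1), (c k * (D.choose k : ℝ)) *
          (evalBool p x ^ k * (1 - evalBool p x) ^ (D - k)) := by
    intro c x
    unfold evalBool
    rw [map_sum]
    refine Finset.sum_congr rfl fun k _ => ?_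
    simp only [map_mul, map_pow, eval_C, map_sub, map_one]
    ring
  -- binomial theorem on the cube: `Σ_k (D choose k) e^k (1-e)^(D-k) = 1`
  have binom : ∀ x : Fin N → Bool,
      ∑ k ∈ Finset.range (D + 1), (D.choose k : ℝ) * (evalBool p x ^ k * (1 - evalBool p x) ^ (D - k))
        = 1 := by
    intro x
    have h := add_pow (evalBool p x) (1 - evalBool p x) D
    rw [show evalBool p x + (1 - evalBool p x) = 1 by ring, one_pow] at h
    refine Eq.trans (Finset.sum_congr rfl fun k _ => ?_) h.symm
    ring
  refine ⟨?_, ?_⟩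
  · refine (CubeSOS.sum (Finset.range (D + 1))
      (fun k x => (b k * (D.choose k : ℝ)) * (evalBool p x ^ k * (1 - evalBool p x) ^ (D - k)))
      fun k hk => (basis k hk).smul (mul_nonneg (hb0 k) (Nat.cast_nonneg _))).congr fun x => ?_
    rw [evB]
  · refine (CubeSOS.sum (Finset.range (D + 1))
      (fun k x => ((1 - b k) * (D.choose k : ℝ)) * (evalBool p x ^ k * (1 - evalBool p x) ^ (D - k)))
      fun k hk => (basis k hk).smul (mul_nonneg (sub_nonneg.mpr (hb1 k)) (Nat.cast_nonneg _))).congr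
      fun x => ?_
    rw [evB]
    have hsplit : ∑ k ∈ Finset.range (D + 1),
        (1 - b k) * (D.choose k : ℝ) * (evalBool p x ^ k * (1 - evalBool p x) ^ (D - k)) =
        ∑ k ∈ Finset.range (D + 1), (D.choose k : ℝ) * (evalBool p x ^ k * (1 - evalBool p x) ^ (D - k)) -
          ∑ k ∈ Finset.range (D + 1),
            b k * (D.choose k : ℝ) * (evalBool p x ^ k * (1 - evalBool p x) ^ (D - k)) := by
      rw [← Finset.sum_sub_distrib]
      exact Finset.sum_congr rfl fun k _ => by ring
    rw [hsplit, binom x]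

/-- `Maj₃` post-processing: `3p² - 2p³ ∈ K_{3T}` for `p ∈ K_T` (`= p² + 2 p² (1-p)`, complement
`(1-p)² + 2 (1-p)² p`). The inner booster of the saturation amplifier. [folklore] -/
theorem maj₃ (h : PseudoBounded T p) : PseudoBounded (3 * T) (3 * p ^ 2 - 2 * p ^ 3) := by
  rw [pseudoBounded_iff_cubeSOS] at h ⊢
  obtain ⟨hq, hr⟩ := h
  have hpp : CubeSOS (2 * T) (fun x => evalBool p x * evalBool p x) := by
    simpa [two_mul] using hq.mul hq
  have hrr : CubeSOS (2 * T) (fun x => (1 - evalBool p x) * (1 - evalBool p x)) := by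
    simpa [two_mul] using hr.mul hr
  have h3 : 2 * T + T = 3 * T := by ring
  have A : CubeSOS (3 * T) (fun x => evalBool p x * evalBool p x * (1 - evalBool p x)) := by
    simpa [h3] using hpp.mul hr
  have B : CubeSOS (3 * T) (fun x => (1 - evalBool p x) * (1 - evalBool p x) * evalBool p x) := by
    simpa [h3] using hrr.mul hq
  refine ⟨((hpp.mono (by omega)).add (A.smul (by norm_num : (0:ℝ) ≤ 2))).congr fun x => ?_,
    ((hrr.mono (by omega)).add (B.smul (by norm_num : (0:ℝ) ≤ 2))).congr fun x => ?_⟩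
  · unfold evalBool; simp only [map_sub, map_mul, map_pow, map_ofNat]; ring
  · unfold evalBool; simp only [map_sub, map_mul, map_pow, map_ofNat]; ring

end PseudoBounded

/-! ## §2 Variance bookkeeping: the top band is the near-Boolean, near-balanced corner -/

/-- Linearity of the cube average (local copies; the tree's `boolAvg_add/sub/const_mul` live in a
module whose import closure is heavier than this node needs). [folklore] -/
theorem avg_add (f g : (Fin N → Bool) → ℝ) : boolAvg (fun y => f y + g y) = boolAvg f + boolAvg g := by
  unfold boolAvg; rw [Finset.sum_add_distrib, add_div]

/-- Linearity of the cube average. [folklore] -/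
theorem avg_sub (f g : (Fin N → Bool) → ℝ) : boolAvg (fun y => f y - g y) = boolAvg f - boolAvg g := by
  unfold boolAvg; rw [Finset.sum_sub_distrib, sub_div]

/-- Linearity of the cube average. [folklore] -/
theorem avg_const_mul (a : ℝ) (f : (Fin N → Bool) → ℝ) :
    boolAvg (fun y => a * f y) = a * boolAvg f := by
  unfold boolAvg; rw [← Finset.mul_sum, mul_div_assoc]

/-- `Var[p] = μ(1-μ) - E[p(1-p)]` on the cube (`μ = E p`). [folklore] -/
theorem boolVariance_eq_corner (p : MvPolynomial (Fin N) ℝ) :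
    boolVariance p = boolAvg (evalBool p) * (1 - boolAvg (evalBool p)) -
      boolAvg (fun x => evalBool p x * (1 - evalBool p x)) := by
  unfold boolVariance
  have h1 : (fun x => (evalBool p x - boolAvg (evalBool p)) ^ 2) =
      fun x => (boolAvg (evalBool p) * boolAvg (evalBool p) - evalBool p x * (1 - evalBool p x)) +
        (1 - 2 * boolAvg (evalBool p)) * evalBool p x := by
    funext x; ring
  rw [h1, avg_add, avg_sub, boolAvg_const, avg_const_mul (1 - 2 * boolAvg (evalBool p)) (evalBool p)]
  ring

/-- For a `[0,1]`-valued `p`: `Var[p] ≤ 1/4 - E[p(1-p)] - (μ - 1/2)²`; in particular `Var ≤ 1/4`, and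
the TOP BAND `Var ≥ 1/4 - η` forces `E[p(1-p)] ≤ η` (near-Boolean) and `(μ - 1/2)² ≤ η`
(near-balanced). [folklore] -/
theorem nearCorner_of_topBand {T : ℕ} {p : MvPolynomial (Fin N) ℝ} (h : PseudoBounded T p) {η : ℝ}
    (hv : 1 / 4 - η ≤ boolVariance p) :
    boolAvg (fun x => evalBool p x * (1 - evalBool p x)) ≤ η ∧
      (boolAvg (evalBool p) - 1 / 2) ^ 2 ≤ η := by
  have key := boolVariance_eq_corner p
  have hδ : 0 ≤ boolAvg (fun x => evalBool p x * (1 - evalBool p x)) :=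
    boolAvg_nonneg fun x => mul_nonneg (h.eval_nonneg x) (sub_nonneg.mpr (h.eval_le_one x))
  set μ := boolAvg (evalBool p)
  set δ := boolAvg (fun x => evalBool p x * (1 - evalBool p x))
  have hsq : μ * (1 - μ) = 1 / 4 - (μ - 1 / 2) ^ 2 := by ring
  have hsum : δ + (μ - 1 / 2) ^ 2 ≤ η := by linarith
  constructor <;> nlinarith [sq_nonneg (μ - 1 / 2)]

/-- A pseudo-bounded polynomial has `E[p(1-p)] ≥ 0` and hence `Var[p] ≤ 1/4`. [folklore] -/
theorem boolVariance_le_quarter {T : ℕ} {p : MvPolynomial (Fin N) ℝ} (h : PseudoBounded T p) :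
    boolVariance p ≤ 1 / 4 := by
  have key := boolVariance_eq_corner p
  have hδ : 0 ≤ boolAvg (fun x => evalBool p x * (1 - evalBool p x)) :=
    boolAvg_nonneg fun x => mul_nonneg (h.eval_nonneg x) (sub_nonneg.mpr (h.eval_le_one x))
  nlinarith [sq_nonneg (boolAvg (evalBool p) - 1 / 2)]

/-! ## §3 The corner is inhabited at order 1: a dictator (`Var = 1/4`, `Inf = 1`) -/

/-- Sums over the one-bit cube. [folklore] -/
theorem sum_cube_one (F : (Fin 1 → Bool) → ℝ) :
    ∑ x : Fin 1 → Bool, F x = F (fun _ => true) + F (fun _ => false) := by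
  rw [← (Equiv.funUnique (Fin 1) Bool).symm.sum_comp F, Fintype.sum_bool]
  rfl

/-- The dictator `X₀` on one bit: values. [folklore] -/
theorem evalBool_dictator (x : Fin 1 → Bool) :
    evalBool (X 0 : MvPolynomial (Fin 1) ℝ) x = if x 0 then 1 else 0 := by
  simp [evalBool]

/-- The dictator has mean `1/2`. [folklore] -/
theorem boolAvg_dictator : boolAvg (evalBool (X 0 : MvPolynomial (Fin 1) ℝ)) = 1 / 2 := by
  unfold boolAvg
  rw [sum_cube_one]
  simp [evalBool_dictator]

/-- The dictator sits AT the corner: `Var[X₀] = 1/4`. [folklore] -/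
theorem boolVariance_dictator : boolVariance (X 0 : MvPolynomial (Fin 1) ℝ) = 1 / 4 := by
  unfold boolVariance
  rw [boolAvg_dictator]
  unfold boolAvg
  rw [sum_cube_one]
  simp [evalBool_dictator]
  all_goals norm_num

/-- The dictator's influence is `1`. [folklore] -/
theorem influence_dictator (j : Fin 1) : influence j (X 0 : MvPolynomial (Fin 1) ℝ) = 1 := by
  have hj : j = 0 := Subsingleton.elim _ _
  subst hj
  unfold influence boolAvg
  rw [sum_cube_one]
  simp [evalBool_dictator, flipBit]

end Summit.QuantumAdvantage.QuantumAdvantage.Theorems.SosSandwich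

end
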